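import Mathlib.Algebra.Module.ZLattice.Basic
import Mathlib.LinearAlgebra.FreeModule.PID
import HarnessLib

/-!
# Crux NUM `CartanOnePlaceDegreeLawAtThree` (item 24801), line `petarea` — stub (D) `PeriodLatticeDiscrete`, slice 1:
# INTEGER COORDINATES — an additive subgroup that maps injectively into a `ℤ`-lattice is free of finite rank with an
# `ℝ`-linearly independent `ℤ`-basis

Seat `bsd-stepL-tam3-p1` g31 (LEAD of crux 24801; `--supports stmt-BirchSwinnertonDyer-24801 --as helper`). The pure
linear-algebra half of the registered content stub `stub_periodLatticeDiscrete` of `Cruxes/CartanOnePlaceDegreeLawAtThree/Lines/petarea.lean`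
v4 (D = DISCRETENESS OF THE PERIOD LATTICE `𝕃(u, Λ)`): for an `ℝ`-module `V`, an additive subgroup `𝕃 ≤ V`, a finite-dimensional
real normed space `E` with a full `ℤ`-lattice `M` (`IsZLattice`), and an `ℝ`-linear map `Φ : V → E` carrying `𝕃` into `M` and
injective on `𝕃`, there are integer coordinates `e : 𝕃 ≃ₗ[ℤ] ℤ^dd` whose coordinate vectors `e⁻¹(δ_i)` are `ℝ`-LINEARLY
INDEPENDENT in `V` (`exists_equiv_linearIndependent`; the instance `ℤ^ι ⊆ ℝ^ι`: `exists_equiv_linearIndependent_pi`). Proof: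
Smith normal form of `Φ(𝕃) ≤ M` against a `ℤ`-basis of `M` (Mathlib `Submodule.smithNormalForm`), which is an `ℝ`-basis of `E`
(Mathlib `Module.Basis.ofZLatticeBasis`), then `LinearIndependent.of_comp`. In the consumer (slice 3) `V` = the induced cusp-form
module of the cover, `𝕃 = R.periodLattice Λ_L u`, `Φ` = the integer period coordinates, injective by Eichler–Shimura injectivity on
`S₂(Γ̄(q))` (slice 2). Pure Mathlib algebra; nothing about NUM or any curve; BSD is proved for no curve. [folklore]
-/

set_option linter.dupNamespace false
set_option autoImplicit false

noncomputable section

namespace Summit.BirchSwinnertonDyer.BirchSwinnertonDyer.Theorems.CartanCover.LatticeCoords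

open Module

section General

variable {E : Type*} [NormedAddCommGroup E] [NormedSpace ℝ E] [FiniteDimensional ℝ E]
  (M : Submodule ℤ E) [DiscreteTopology M] [IsZLattice ℝ M]

/-- **A sub-`ℤ`-module `N` of a full `ℤ`-lattice `M ⊆ E` has a `ℤ`-basis whose vectors are `ℝ`-linearly independent in `E`**
(Smith normal form `bN i = a_i • bM (f i)` against a `ℤ`-basis `bM` of `M`, which is an `ℝ`-basis of `E`; `a_i ≠ 0`). [folklore] -/
theorem exists_basis_linearIndependent (N : Submodule ℤ M) :
    ∃ (n : ℕ) (b : Basis (Fin n) ℤ N), LinearIndependent ℝ fun i => ((b i : M) : E) := by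
  classical
  haveI : Module.Free ℤ M := ZLattice.module_free ℝ M
  haveI : Module.Finite ℤ M := ZLattice.module_finite ℝ M
  obtain ⟨n, snf⟩ := Submodule.smithNormalForm (Module.Free.chooseBasis ℤ M) N
  refine ⟨n, snf.bN, ?_⟩
  -- the `ℤ`-basis `bM` of `M` is an `ℝ`-basis of `E`, so `j ↦ bM j` and `i ↦ bM (f i)` are `ℝ`-independent
  have hM : LinearIndependent ℝ fun j => ((snf.bM j : M) : E) := by
    have h := (snf.bM.ofZLatticeBasis ℝ M).linearIndependent
    refine (linearIndependent_equiv' (Equiv.refl _) ?_).mp h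
    funext j
    simp [Basis.ofZLatticeBasis_apply]
  have hMf : LinearIndependent ℝ ((fun j => ((snf.bM j : M) : E)) ∘ snf.f) := hM.comp snf.f snf.f.injective
  -- the diagonal entries are non-zero (`bN i ≠ 0`)
  have ha : ∀ i, (snf.a i : ℝ) ≠ 0 := by
    intro i h0
    have h0' : snf.a i = 0 := by exact_mod_cast h0
    have h1 : (snf.bN i : M) = 0 := by rw [snf.snf i, h0', zero_smul]
    exact snf.bN.ne_zero i (Subtype.ext (by rw [h1]; rfl))
  -- `bN i = a_i • bM (f i)` in `E`
  have hw := hMf.units_smul fun i => Units.mk0 (snf.a i : ℝ) (ha i)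
  refine (linearIndependent_equiv' (Equiv.refl _) ?_).mp hw
  funext i
  simp only [Equiv.coe_refl, Function.comp_apply, Pi.smul_apply', Units.smul_mk0, id_eq]
  rw [snf.snf i, Submodule.coe_smul, Int.cast_smul_eq_zsmul]

variable {M}

/-- **INTEGER COORDINATES WITH INDEPENDENT COORDINATE VECTORS.** `V` an `ℝ`-module, `𝕃 ≤ V` an additive subgroup,
`Φ : V →ₗ[ℝ] E` with `Φ(𝕃) ⊆ M` (a full `ℤ`-lattice of the finite-dimensional `E`) and `Φ` injective on `𝕃`: then
`𝕃 ≃ₗ[ℤ] ℤ^dd` for some `dd`, by coordinates whose coordinate vectors are `ℝ`-linearly independent in `V`. [folklore] -/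
theorem exists_equiv_linearIndependent {V : Type*} [AddCommGroup V] [Module ℝ V] (𝕃 : AddSubgroup V)
    (Φ : V →ₗ[ℝ] E) (hM : ∀ x ∈ 𝕃, Φ x ∈ M) (hinj : ∀ x ∈ 𝕃, Φ x = 0 → x = 0) :
    ∃ (dd : ℕ) (e : 𝕃 ≃ₗ[ℤ] (Fin dd → ℤ)),
      LinearIndependent ℝ fun i : Fin dd => ((e.symm (Pi.single i 1) : 𝕃) : V) := by
  classical
  -- `ψ : 𝕃 → M`, the corestriction of `Φ`, is an injective `ℤ`-linear map
  let ψ : 𝕃 →ₗ[ℤ] M :=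
    { toFun := fun x => ⟨Φ (x : V), hM x x.2⟩
      map_add' := fun x y => by
        apply Subtype.ext
        simp only [AddSubgroup.coe_add, map_add, Submodule.coe_add]
      map_smul' := fun c x => by
        apply Subtype.ext
        simp only [AddSubgroupClass.coe_zsmul, map_zsmul, RingHom.id_apply, Submodule.coe_smul] }
  have hψv : ∀ x : 𝕃, ((ψ x : M) : E) = Φ (x : V) := fun x => rfl
  have hψ : Function.Injective ψ := by
    intro x y hxy
    have h : Φ ((x : V) - y) = 0 := by
      rw [map_sub, sub_eq_zero, ← hψv, ← hψv, hxy]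
    have h2 := hinj _ (𝕃.sub_mem x.2 y.2) h
    exact Subtype.ext (sub_eq_zero.mp h2)
  -- a `ℤ`-basis of the image with `ℝ`-independent vectors, transported back to `𝕃`
  obtain ⟨n, b, hb⟩ := exists_basis_linearIndependent M (LinearMap.range ψ)
  let eN : 𝕃 ≃ₗ[ℤ] LinearMap.range ψ := LinearEquiv.ofInjective ψ hψ
  let bL : Basis (Fin n) ℤ 𝕃 := b.map eN.symm
  refine ⟨n, bL.equivFun, ?_⟩
  have hsymm : ∀ i, bL.equivFun.symm (Pi.single i 1) = bL i := fun i => by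
    rw [Basis.equivFun_symm_apply]
    simp [Pi.single_apply]
  simp_rw [hsymm]
  refine LinearIndependent.of_comp Φ ?_
  have hcomp : (⇑Φ ∘ fun i => ((bL i : 𝕃) : V)) = fun i => (((b i : LinearMap.range ψ) : M) : E) := by
    funext i
    simp only [Function.comp_apply, bL, Basis.map_apply]
    rw [← hψv, ← LinearEquiv.ofInjective_apply ψ (h := hψ), LinearEquiv.apply_symm_apply]
  rw [hcomp]
  exact hb

end General

/-! ## The instance `ℤ^ι ⊆ ℝ^ι` -/

/-- **Integer vectors.** `Φ : V →ₗ[ℝ] ℝ^ι` (`ι` finite) taking INTEGER values on the additive subgroup `𝕃` and injective there: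
`𝕃 ≃ₗ[ℤ] ℤ^dd` with `ℝ`-linearly independent coordinate vectors. [folklore] -/
theorem exists_equiv_linearIndependent_pi {ι : Type*} [Fintype ι] {V : Type*} [AddCommGroup V] [Module ℝ V]
    (𝕃 : AddSubgroup V) (Φ : V →ₗ[ℝ] (ι → ℝ)) (hint : ∀ x ∈ 𝕃, ∀ i, ∃ n : ℤ, Φ x i = n)
    (hinj : ∀ x ∈ 𝕃, Φ x = 0 → x = 0) :
    ∃ (dd : ℕ) (e : 𝕃 ≃ₗ[ℤ] (Fin dd → ℤ)),
      LinearIndependent ℝ fun i : Fin dd => ((e.symm (Pi.single i 1) : 𝕃) : V) := by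
  classical
  refine exists_equiv_linearIndependent (M := Submodule.span ℤ (Set.range ⇑(Pi.basisFun ℝ ι))) 𝕃 Φ ?_ hinj
  intro x hx
  rw [Basis.mem_span_iff_repr_mem ℤ (Pi.basisFun ℝ ι)]
  intro i
  obtain ⟨n, hn⟩ := hint x hx i
  exact ⟨n, by rw [Pi.basisFun_repr, hn]; simp⟩

end Summit.BirchSwinnertonDyer.BirchSwinnertonDyer.Theorems.CartanCover.LatticeCoords

end
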